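import Literature.Analysis.Complex.InjectiveHolomorphic
import Mathlib.Geometry.Manifold.MFDeriv.Basic
import HarnessLib

/-!
# A holomorphic homeomorphism of complex manifolds has holomorphic inverse (crux
# `EndoscopicMiddleDegree.OrthogonalEnveloped`, stmt-HodgeConjecture-14300; `--supports`)

**Clements–Osgood on manifolds** (Fritzsche–Grauert, Ch. I §8, Thm. 8.5 and Cor. 8.6, read in
charts): a homeomorphism `h : M ≃ₜ M'` between complex manifolds over *boundaryless* models on
normed spaces `E`, `E'` of the same finite dimension which is holomorphic (`MDifferentiable`) has
holomorphic inverse. This is the registered stub `stub_symmHolomorphicOfHomeomorph` (sub-stub O of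
the construction S2b of the line purity-sorted-hecke-envelope), consumed by the comparison of a
Hodge model of `X ⊗ X` with the square of a Hodge model of `X`.

Proof. Fix `y : M'` and put `x = h⁻¹ y`. The models being boundaryless, the extended charts
`φ = extChartAt I x : M ⇀ E` and `ψ = extChartAt I' y : M' ⇀ E'` are *open partial homeomorphisms*
(the charts followed by the homeomorphisms `I.toHomeomorph : H ≃ₜ E`, `I'.toHomeomorph`), hence so
is the transition map `T = ψ ∘ h ∘ φ⁻¹ : E ⇀ E'`. It is complex-differentiable on its (open)
source, `h` being `MDifferentiable` (read in the charts `φ`, `ψ`: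
`mdifferentiableAt_iff_of_mem_source`). By the tree's PROVED
`Literature.Analysis.Complex.SCV.differentiableOn_symm_of_differentiableOn` (Thm. 8.5: the
differential of an injective holomorphic map between spaces of the same dimension is invertible;
then the inverse function theorem) `T⁻¹ = φ ∘ h⁻¹ ∘ ψ⁻¹` is complex-differentiable on the target of
`T`, in particular at `ψ y = T (φ x)`; read back through `mdifferentiableAt_iff_of_mem_source` this
is `MDifferentiableAt I' I h⁻¹ y`.

References: K. Fritzsche, H. Grauert, *From Holomorphic Functions to Complex Manifolds*, GTM 213
(2002), Ch. I §8, Thm. 8.5, Cor. 8.6 [FritzscheGrauert2002].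
-/

noncomputable section

-- The crux-workfile namespace `Summit.<P>.<Sub>.Cruxes.…` repeats `HodgeConjecture` (single-conjunct summit).
set_option linter.dupNamespace false

namespace Summit.HodgeConjecture.HodgeConjecture.Cruxes.OrthogonalEnveloped.HeckeGraphChow

open scoped Manifold ContDiff Topology
open Set Filter

/-- **REGISTERED STUB `stub_symmHolomorphicOfHomeomorph` (Clements–Osgood on manifolds).** A
holomorphic homeomorphism `h : M ≃ₜ M'` between complex manifolds over boundaryless models on
normed spaces of the same finite dimension has holomorphic inverse: in extended charts at
`x = h⁻¹ y` and `y` the transition map `T = ψ ∘ h ∘ φ⁻¹` is an injective holomorphic open partial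
homeomorphism `E ⇀ E'`, so its inverse `φ ∘ h⁻¹ ∘ ψ⁻¹` is holomorphic on the target
(`Literature.Analysis.Complex.SCV.differentiableOn_symm_of_differentiableOn`), which is the chart
expression of `MDifferentiableAt I' I h⁻¹ y`. [cite: FritzscheGrauert2002, Ch. I §8 Cor. 8.6] -/
theorem stub_symmHolomorphicOfHomeomorph :
    ∀ {E : Type} [NormedAddCommGroup E] [NormedSpace ℂ E] [FiniteDimensional ℂ E]
      {H : Type} [TopologicalSpace H] {I : ModelWithCorners ℂ E H} [I.Boundaryless]
      {M : Type} [TopologicalSpace M] [ChartedSpace H M] [IsManifold I 1 M]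
      {E' : Type} [NormedAddCommGroup E'] [NormedSpace ℂ E'] [FiniteDimensional ℂ E']
      {H' : Type} [TopologicalSpace H'] {I' : ModelWithCorners ℂ E' H'} [I'.Boundaryless]
      {M' : Type} [TopologicalSpace M'] [ChartedSpace H' M'] [IsManifold I' 1 M']
      (h : M ≃ₜ M'), Module.finrank ℂ E = Module.finrank ℂ E' →
      MDifferentiable I I' h → MDifferentiable I' I h.symm := by
  intro E _ _ _ H _ I _ M _ _ _ E' _ _ _ H' _ I' _ M' _ _ _ h hdim hh y
  -- the point `x = h⁻¹ y`, and the extended charts at `x` and `y` as open partial homeomorphisms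
  set x : M := h.symm y
  have hxy : h x = y := h.apply_symm_apply y
  set φ : OpenPartialHomeomorph M E :=
    (chartAt H x).trans I.toHomeomorph.toOpenPartialHomeomorph with hφ
  set ψ : OpenPartialHomeomorph M' E' :=
    (chartAt H' y).trans I'.toHomeomorph.toOpenPartialHomeomorph with hψ
  have hφc : (φ : M → E) = extChartAt I x := rfl
  have hψc : (ψ : M' → E') = extChartAt I' y := rfl
  have hφsrc : φ.source = (chartAt H x).source := by
    simp [hφ]
  have hψsrc : ψ.source = (chartAt H' y).source := by
    simp [hψ]
  have hxφ : x ∈ φ.source := hφsrc ▸ mem_chart_source H x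
  -- the transition map `T = ψ ∘ h ∘ φ⁻¹ : E ⇀ E'` and its inverse `φ ∘ h⁻¹ ∘ ψ⁻¹`
  set T : OpenPartialHomeomorph E E' := φ.symm.trans (h.toOpenPartialHomeomorph.trans ψ) with hT
  have hTc : (T : E → E') = extChartAt I' y ∘ h ∘ (extChartAt I x).symm := rfl
  have hTsc : (T.symm : E' → E) = extChartAt I x ∘ h.symm ∘ (extChartAt I' y).symm := rfl
  have hTsrc : ∀ e, e ∈ T.source ↔ e ∈ φ.target ∧ h (φ.symm e) ∈ (chartAt H' y).source := by
    intro e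
    simp [hT, hψsrc]
  -- `T` is complex-differentiable on its source (`h` is holomorphic, read in the charts `φ`, `ψ`)
  have hTd : DifferentiableOn ℂ T T.source := by
    intro e he
    obtain ⟨he₁, he₂⟩ := (hTsrc e).1 he
    have hex : φ.symm e ∈ (chartAt H x).source := hφsrc ▸ φ.map_target he₁
    have hmd := ((mdifferentiableAt_iff_of_mem_source (I := I) (I' := I') (f := h) hex he₂).1
      (hh _)).2
    rw [I.range_eq_univ, differentiableWithinAt_univ] at hmd
    have hee : extChartAt I x (φ.symm e) = e := φ.right_inv he₁
    rw [hee] at hmd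
    rw [hTc]
    exact hmd.differentiableWithinAt
  -- Clements–Osgood (Fritzsche–Grauert Thm. 8.5, Cor. 8.6): `T⁻¹` is holomorphic on the target
  have hTsd :=
    Literature.Analysis.Complex.SCV.differentiableOn_symm_of_differentiableOn hdim T hTd
  -- `ψ y = T (φ x)` lies in the (open) target of `T`
  have hxT : φ x ∈ T.source := by
    refine (hTsrc _).2 ⟨φ.map_source hxφ, ?_⟩
    rw [φ.left_inv hxφ, hxy]
    exact mem_chart_source H' y
  have hyT : ψ y ∈ T.target := by
    have h1 : T (φ x) = ψ y := by
      show ψ (h (φ.symm (φ x))) = ψ y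
      rw [φ.left_inv hxφ, hxy]
    exact h1 ▸ T.map_source hxT
  have hdiff : DifferentiableAt ℂ (extChartAt I x ∘ h.symm ∘ (extChartAt I' y).symm)
      (extChartAt I' y y) := by
    rw [← hTsc, ← hψc]
    exact (hTsd _ hyT).differentiableAt (T.open_target.mem_nhds hyT)
  -- read back on the manifolds through the charts `ψ` at `y` and `φ` at `x = h⁻¹ y`
  have hxs : h.symm y ∈ (chartAt H x).source := mem_chart_source H x
  refine (mdifferentiableAt_iff_of_mem_source (I := I') (I' := I) (f := h.symm)
    (mem_chart_source H' y) hxs).2 ⟨h.symm.continuous.continuousAt, ?_⟩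
  rw [I'.range_eq_univ, differentiableWithinAt_univ]
  exact hdiff

end Summit.HodgeConjecture.HodgeConjecture.Cruxes.OrthogonalEnveloped.HeckeGraphChow

end
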